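import Summits.CriticalPhenomena.SAWScalingLimit.Theorems.SAWRenewalTightnessStripMassConservation

/-!
# `ShellCrossingBound`, line `kesten-defect-renewal`, stub S2 `stub_stripDecay_of_tiltedKraft`

Crux item `stmt-CriticalPhenomena-4728` (`SAWRenewalTightness.ShellCrossingBound`), registered stub
`stub_stripDecay_of_tiltedKraft` (S2, "strip renewal"): the tilted Kraft inequality for Kesten's
irreducible bridges confined to the width-`W` strip (stub S1, the hypothesis) implies exponential
decay at rate `∝ 1/W`, amplitude linear in `W`, of the critical mass `u^W_L(y, y')` of strip
bridges of span `L` (vertex functions `ω ∈ Zd.bridges 2 n` with `ω n 0 = L`, `y + ω n 1 = y'`,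
`0 ≤ y + ω i 1 < W` for `i ≤ n`, weighted `x_c^n`, all partial sums in `n`). Madras–Slade §4.2
renewal run INSIDE the strip at the plane's `x_c`, in the step-word model (`SAWWords.lean`,
`SAWWordBridges.lean`); vocabulary inline (no definitions): heights = coordinate `1`, spans =
coordinate `0`; a word `w` *fits from `y`* if `0 ≤ y + (traj w i) 1 < W` for `i ≤ |w|`; the strip
bridge words of length `≤ N` from `y` are the self-avoiding bridge words fitting from `y`, with
tilted mass `S_N(y) = Σ_w x_c^{|w|} e^{u · xEnd w}`.

* `StripRenewal.stripWordMass_le` — the renewal induction on `N`: if every row sum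
  `Σ_{β ∈ S fitting from y''} x_c^{|β|} e^{u·xEnd β}` (`S` a finite set of irreducible bridges) is
  `≤ q` and `1 + qB ≤ B`, `1 ≤ B`, then `S_N(y) ≤ B` (a non-empty word is `β ++ t`, `β` irreducible
  fitting from `y`, `t` a shorter strip bridge word from `y + (wEnd β) 1`;
  `StripMass.exists_irrBridge_append`, multiplicativity of the weight);
* `StripRenewal.stripWordMass_span_le` — restricting to span `L` costs `e^{-uL}`;
* `StripRenewal.rowBound_of_tiltedKraft` — S1 at tilt `c/W` gives row sums `≤ e^{-u}` at
  `u = c/(2W)` (every irreducible bridge has span `≥ 1`);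
* `StripRenewal.stripBridgeMass_le_wordMass` — transfer vertex functions → words (`wordOf`);
* the stub: `B = (u+1)/u ≤ (2/c + 1) W`, rate `c/2`, amplitude `2/c + 1`. Kesten's identity is
  not used.

References: H. Kesten, J. Math. Phys. 4 (1963), §4; N. Madras, G. Slade, *The Self-Avoiding Walk*
(1993), §4.2, eqs. (4.2.1)–(4.2.12), Lemma 4.1.11.
-/

open Finset
open Literature.Probability.RandomPlanarGeometry Literature.Probability.LatticeModels
open scoped BigOperators Classical

namespace Summit.CriticalPhenomena.SAWScalingLimit.Theorems

namespace StripRenewal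

open Literature.Probability.RandomPlanarGeometry.SAW

/-! ### Fitting in the strip -/

/-- A prefix of a word fitting in heights `[0, W)` from `y` fits from `y`. [folklore] -/
theorem fits_left {W : ℕ} {y : ℤ} {β t : List Step}
    (h : ∀ i ≤ (β ++ t).length, 0 ≤ y + traj (β ++ t) i 1 ∧ y + traj (β ++ t) i 1 < W) :
    ∀ i ≤ β.length, 0 ≤ y + traj β i 1 ∧ y + traj β i 1 < W := by
  intro i hi
  have := h i (by rw [List.length_append]; omega)
  rwa [traj_append_left β t hi] at this

/-- The suffix `t` of a word `β ++ t` fitting from `y` fits from the height `y + (wEnd β) 1`.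
[folklore] -/
theorem fits_right {W : ℕ} {y : ℤ} {β t : List Step}
    (h : ∀ i ≤ (β ++ t).length, 0 ≤ y + traj (β ++ t) i 1 ∧ y + traj (β ++ t) i 1 < W) :
    ∀ i ≤ t.length, 0 ≤ y + wEnd β 1 + traj t i 1 ∧ y + wEnd β 1 + traj t i 1 < W := by
  intro i hi
  have := h (β.length + i) (by rw [List.length_append]; omega)
  rwa [traj_append_right β t i, Pi.add_apply, ← add_assoc] at this

/-- The height reached at the end of a fitting word lies in `[0, W)`. [folklore] -/
theorem endHeight_mem {W : ℕ} {y : ℤ} {β : List Step}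
    (h : ∀ i ≤ β.length, 0 ≤ y + traj β i 1 ∧ y + traj β i 1 < W) :
    0 ≤ y + wEnd β 1 ∧ y + wEnd β 1 < W := by
  simpa only [traj_length] using h β.length le_rfl

/-- Membership in the finite set of strip bridge words of length `≤ N` from height `y`.
[folklore] -/
theorem mem_stripWords {W N : ℕ} {y : ℤ} {w : List Step} :
    w ∈ ((Finset.range (N + 1)).biUnion sawWords).filter
        (fun w => IsBridgeW w ∧ ∀ i ≤ w.length, 0 ≤ y + traj w i 1 ∧ y + traj w i 1 < W) ↔
      w.length ≤ N ∧ IsSAW w ∧ IsBridgeW w ∧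
        ∀ i ≤ w.length, 0 ≤ y + traj w i 1 ∧ y + traj w i 1 < W := by
  simp only [Finset.mem_filter, Finset.mem_biUnion, Finset.mem_range, mem_sawWords]
  constructor
  · rintro ⟨⟨n, hn, hl, hs⟩, hb, hf⟩
    exact ⟨by omega, hs, hb, hf⟩
  · rintro ⟨hl, hs, hb, hf⟩
    exact ⟨⟨w.length, by omega, rfl, hs⟩, hb, hf⟩

/-! ### The tilted weight `x_c^{|w|} e^{u · span}` -/

/-- The tilted weight of the empty word is `1`. [folklore] -/
theorem weight_nil (u : ℝ) :
    criticalFugacity ^ ([] : List Step).length *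
      Real.exp (u * (xEnd ([] : List Step) : ℝ)) = 1 := by
  simp [xEnd]

/-- The tilted weight is multiplicative under concatenation.
[cite: MadrasSlade1993, §4.2, eq. (4.2.2)] -/
theorem weight_append (u : ℝ) (β t : List Step) :
    criticalFugacity ^ (β ++ t).length * Real.exp (u * (xEnd (β ++ t) : ℝ)) =
      criticalFugacity ^ β.length * Real.exp (u * (xEnd β : ℝ)) *
        (criticalFugacity ^ t.length * Real.exp (u * (xEnd t : ℝ))) := by
  rw [List.length_append, pow_add, xEnd_append, Int.cast_add, mul_add, Real.exp_add]
  ring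

/-- The tilted weight is non-negative. [folklore] -/
theorem weight_nonneg (u : ℝ) (w : List Step) :
    0 ≤ criticalFugacity ^ w.length * Real.exp (u * (xEnd w : ℝ)) :=
  mul_nonneg (pow_nonneg StripMass.criticalFugacity_pos.le _) (Real.exp_pos _).le

/-! ### The renewal induction inside the strip -/

/-- **Factorisation cover.** Every non-empty strip bridge word of length `≤ N + 1` from `y` is
`β ++ t` with `β` an irreducible bridge of length `≤ N + 1` fitting from `y` and `t` a strip bridge
word of length `≤ N` from `y + (wEnd β) 1` (`StripMass.exists_irrBridge_append`, `|β| ≥ 1`).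
[cite: MadrasSlade1993, §4.2, eq. (4.2.1)–(4.2.2)] -/
theorem stripWords_erase_nil_subset (W N : ℕ) (y : ℤ) :
    (((Finset.range (N + 1 + 1)).biUnion sawWords).filter
        (fun w => IsBridgeW w ∧ ∀ i ≤ w.length, 0 ≤ y + traj w i 1 ∧ y + traj w i 1 < W)).erase [] ⊆
      (((((Finset.range (N + 1 + 1)).biUnion sawWords).filter fun s => IsIrrBridge s).filter
          (fun s => ∀ i ≤ s.length, 0 ≤ y + traj s i 1 ∧ y + traj s i 1 < W)).sigma
        (fun β => ((Finset.range (N + 1)).biUnion sawWords).filter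
          (fun w => IsBridgeW w ∧ ∀ i ≤ w.length,
            0 ≤ y + wEnd β 1 + traj w i 1 ∧ y + wEnd β 1 + traj w i 1 < W))).image
        (fun p => p.1 ++ p.2) := by
  intro w hw
  obtain ⟨hne, hw⟩ := Finset.mem_erase.1 hw
  obtain ⟨hl, hsaw, hb, hfit⟩ := mem_stripWords.1 hw
  obtain ⟨β, t, rfl, hβ, htb⟩ := StripMass.exists_irrBridge_append hsaw hb hne
  rw [List.length_append] at hl
  have h1 : 1 ≤ β.length := List.length_pos_iff.2 hβ.ne_nil
  refine Finset.mem_image.2 ⟨⟨β, t⟩, Finset.mem_sigma.2 ⟨?_, ?_⟩, rfl⟩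
  · refine Finset.mem_filter.2 ⟨Finset.mem_filter.2 ⟨?_, hβ⟩, fits_left hfit⟩
    exact Finset.mem_biUnion.2 ⟨β.length, Finset.mem_range.2 (by omega),
      mem_sawWords.2 ⟨rfl, hβ.saw⟩⟩
  · show t ∈ _
    refine mem_stripWords.2 ⟨by omega, ?_, htb, fits_right hfit⟩
    simpa only [List.drop_left] using hsaw.drop β.length

/-- **Strip renewal at `x_c`** (Madras–Slade (4.2.2) as an inequality, inside the strip, tilted).
If every row sum `Σ_{β ∈ S fitting from y''} x_c^{|β|} e^{u · xEnd β}` over a finite set `S` of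
irreducible bridges is `≤ q` (all `0 ≤ y'' < W`), `1 ≤ B` and `1 + q · B ≤ B`, then for every `N`
and `0 ≤ y < W` the tilted mass of the strip bridge words of length `≤ N` from `y` is `≤ B`:
induction on `N` — the empty word gives `1`, the others factor through
`stripWords_erase_nil_subset` with multiplicative weight, so the mass is
`≤ 1 + Σ_β x_c^{|β|} e^{u·xEnd β} · B ≤ 1 + q B ≤ B`.
[cite: MadrasSlade1993, §4.2, eq. (4.2.2)–(4.2.3)] -/
theorem stripWordMass_le {W : ℕ} {u q B : ℝ} (hqB : 1 + q * B ≤ B) (hB1 : 1 ≤ B)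
    (hrow : ∀ y : ℤ, 0 ≤ y → y < W → ∀ S : Finset (List Step), (∀ s ∈ S, IsIrrBridge s) →
      ∑ s ∈ S with (∀ i ≤ s.length, 0 ≤ y + traj s i 1 ∧ y + traj s i 1 < W),
        criticalFugacity ^ s.length * Real.exp (u * (xEnd s : ℝ)) ≤ q) (N : ℕ) :
    ∀ y : ℤ, 0 ≤ y → y < W →
      ∑ w ∈ ((Finset.range (N + 1)).biUnion sawWords).filter
          (fun w => IsBridgeW w ∧ ∀ i ≤ w.length, 0 ≤ y + traj w i 1 ∧ y + traj w i 1 < W),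
        criticalFugacity ^ w.length * Real.exp (u * (xEnd w : ℝ)) ≤ B := by
  have hB0 : 0 ≤ B := zero_le_one.trans hB1
  induction N with
  | zero =>
    intro y hy0 hyW
    refine le_trans (Finset.sum_le_sum_of_subset_of_nonneg (t := {[]}) (fun w hw => ?_)
      fun w _ _ => weight_nonneg u w) (by rw [Finset.sum_singleton, weight_nil]; exact hB1)
    have := (mem_stripWords.1 hw).1
    exact Finset.mem_singleton.2 (List.eq_nil_of_length_eq_zero (by omega))
  | succ N ih =>
    intro y hy0 hyW
    have hnil : ([] : List Step) ∈ ((Finset.range (N + 1 + 1)).biUnion sawWords).filter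
        (fun w => IsBridgeW w ∧ ∀ i ≤ w.length, 0 ≤ y + traj w i 1 ∧ y + traj w i 1 < W) :=
      mem_stripWords.2 ⟨by simp, isSAW_nil, isBridgeW_nil,
        fun i _ => by simpa [traj] using ⟨hy0, hyW⟩⟩
    rw [← Finset.add_sum_erase _ _ hnil, weight_nil]
    refine le_trans ?_ hqB
    gcongr 1 + ?_
    -- the irreducible bridges of length `≤ N + 1`
    set S : Finset (List Step) :=
      ((Finset.range (N + 1 + 1)).biUnion sawWords).filter fun s => IsIrrBridge s with hSdef
    have hS : ∀ s ∈ S, IsIrrBridge s := fun s hs => (Finset.mem_filter.1 hs).2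
    -- the induction hypothesis at the heights reached by the fitting irreducible bridges
    have hih : ∀ β ∈ S.filter (fun s => ∀ i ≤ s.length, 0 ≤ y + traj s i 1 ∧ y + traj s i 1 < W),
        ∑ w ∈ ((Finset.range (N + 1)).biUnion sawWords).filter
            (fun w => IsBridgeW w ∧ ∀ i ≤ w.length,
              0 ≤ y + wEnd β 1 + traj w i 1 ∧ y + wEnd β 1 + traj w i 1 < W),
          criticalFugacity ^ w.length * Real.exp (u * (xEnd w : ℝ)) ≤ B := fun β hβ =>
      ih (y + wEnd β 1) (endHeight_mem (Finset.mem_filter.1 hβ).2).1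
        (endHeight_mem (Finset.mem_filter.1 hβ).2).2
    refine (Finset.sum_le_sum_of_subset_of_nonneg (stripWords_erase_nil_subset W N y)
      fun w _ _ => weight_nonneg u w).trans ?_
    refine (Finset.sum_image_le_of_nonneg fun w _ => weight_nonneg u w).trans ?_
    rw [Finset.sum_sigma]
    simp only [weight_append, ← Finset.mul_sum]
    refine (Finset.sum_le_sum fun β hβ =>
      mul_le_mul_of_nonneg_left (hih β hβ) (weight_nonneg u β)).trans ?_
    rw [← Finset.sum_mul]
    exact mul_le_mul_of_nonneg_right (hrow y hy0 hyW S hS) hB0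

/-- **Span restriction.** If the tilted mass of the strip bridge words of length `≤ N` from `y` is
`≤ B`, the untilted `x_c`-mass of those of span `L` is `≤ e^{-uL} · B`.
[cite: MadrasSlade1993, §4.2, eq. (4.2.9)–(4.2.12)] -/
theorem stripWordMass_span_le {W N : ℕ} {u B : ℝ} {y : ℤ}
    (hmass : ∑ w ∈ ((Finset.range (N + 1)).biUnion sawWords).filter
        (fun w => IsBridgeW w ∧ ∀ i ≤ w.length, 0 ≤ y + traj w i 1 ∧ y + traj w i 1 < W),
      criticalFugacity ^ w.length * Real.exp (u * (xEnd w : ℝ)) ≤ B) (L : ℤ) :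
    ∑ w ∈ ((Finset.range (N + 1)).biUnion sawWords).filter
        (fun w => IsBridgeW w ∧ xEnd w = L ∧
          ∀ i ≤ w.length, 0 ≤ y + traj w i 1 ∧ y + traj w i 1 < W),
      criticalFugacity ^ w.length ≤ Real.exp (-(u * L)) * B := by
  have hpt : ∀ w ∈ ((Finset.range (N + 1)).biUnion sawWords).filter
      (fun w => IsBridgeW w ∧ xEnd w = L ∧
        ∀ i ≤ w.length, 0 ≤ y + traj w i 1 ∧ y + traj w i 1 < W),
      criticalFugacity ^ w.length =
        Real.exp (-(u * L)) * (criticalFugacity ^ w.length * Real.exp (u * (xEnd w : ℝ))) := by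
    intro w hw
    rw [(Finset.mem_filter.1 hw).2.2.1, mul_left_comm, ← Real.exp_add, neg_add_cancel,
      Real.exp_zero, mul_one]
  rw [Finset.sum_congr rfl hpt, ← Finset.mul_sum]
  refine mul_le_mul_of_nonneg_left (le_trans (Finset.sum_le_sum_of_subset_of_nonneg
    (fun w hw => ?_) fun w _ _ => weight_nonneg u w) hmass) (Real.exp_pos _).le
  rw [Finset.mem_filter] at hw ⊢
  exact ⟨hw.1, hw.2.1, hw.2.2.2⟩

/-! ### Row sums from the tilted Kraft inequality -/

/-- **Row bound.** If the tilted Kraft inequality with constant `c ≥ 0` holds at `(W, y)` for every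
finite set of (the subtype of) irreducible bridges — stub S1 — then at the half tilt `u = c/(2W)`
every row sum over a finite set `S` of irreducible bridges fitting from `y` is `≤ e^{-u}`: an
irreducible bridge has span `≥ 1` (`StripMass.one_le_xEnd_of_ne_nil`), so
`e^{u · span} ≤ e^{c · span / W} e^{-u}`. [cite: MadrasSlade1993, §4.2, eq. (4.2.4)] -/
theorem rowBound_of_tiltedKraft {c : ℝ} {W : ℕ} {y : ℤ} (hc : 0 ≤ c)
    (h1 : ∀ s : Finset {w : List Step // IsIrrBridge w},
      ∑ w ∈ s with (∀ i ≤ w.1.length, 0 ≤ y + traj w.1 i 1 ∧ y + traj w.1 i 1 < W),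
        criticalFugacity ^ w.1.length * Real.exp (c * (xEnd w.1 : ℝ) / W) ≤ 1)
    (S : Finset (List Step)) (hS : ∀ s ∈ S, IsIrrBridge s) :
    ∑ s ∈ S with (∀ i ≤ s.length, 0 ≤ y + traj s i 1 ∧ y + traj s i 1 < W),
      criticalFugacity ^ s.length * Real.exp (c / 2 / W * (xEnd s : ℝ)) ≤
      Real.exp (-(c / 2 / W)) := by
  have hxc : 0 < criticalFugacity := StripMass.criticalFugacity_pos
  have hcW : 0 ≤ c / 2 / W := by positivity
  have hmem : ∀ s ∈ S.filter (fun s => ∀ i ≤ s.length, 0 ≤ y + traj s i 1 ∧ y + traj s i 1 < W),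
      IsIrrBridge s := fun s hs => hS s (Finset.mem_filter.1 hs).1
  -- the hypothesis on the finite set `S.filter (fits)` of the subtype
  have h1' : ∑ s ∈ S with (∀ i ≤ s.length, 0 ≤ y + traj s i 1 ∧ y + traj s i 1 < W),
      criticalFugacity ^ s.length * Real.exp (c * (xEnd s : ℝ) / W) ≤ 1 := by
    have h := h1 ((S.filter (fun s => ∀ i ≤ s.length,
      0 ≤ y + traj s i 1 ∧ y + traj s i 1 < W)).subtype IsIrrBridge)
    rw [Finset.filter_true_of_mem, Finset.sum_subtype_of_mem
      (fun s : List Step => criticalFugacity ^ s.length * Real.exp (c * (xEnd s : ℝ) / W))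
      hmem] at h
    · exact h
    · exact fun w hw => (Finset.mem_filter.1 (Finset.mem_subtype.1 hw)).2
  -- termwise comparison of the two tilts
  have hterm : ∀ s ∈ S.filter (fun s => ∀ i ≤ s.length, 0 ≤ y + traj s i 1 ∧ y + traj s i 1 < W),
      criticalFugacity ^ s.length * Real.exp (c / 2 / W * (xEnd s : ℝ)) ≤
        Real.exp (-(c / 2 / W)) *
          (criticalFugacity ^ s.length * Real.exp (c * (xEnd s : ℝ) / W)) := by
    intro s hs
    have h1x : (1 : ℝ) ≤ xEnd s := by
      exact_mod_cast StripMass.one_le_xEnd_of_ne_nil (hmem s hs).bridge (hmem s hs).ne_nil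
    rw [mul_left_comm, ← Real.exp_add]
    refine mul_le_mul_of_nonneg_left (Real.exp_le_exp.2 ?_) (pow_nonneg hxc.le _)
    have : c * (xEnd s : ℝ) / W = c / 2 / W * xEnd s + c / 2 / W * xEnd s := by ring
    rw [this]
    nlinarith
  refine (Finset.sum_le_sum hterm).trans ?_
  rw [← Finset.mul_sum]
  exact (mul_le_mul_of_nonneg_left h1' (Real.exp_pos _).le).trans_eq (mul_one _)

/-! ### Transfer: vertex-function strip bridges inject into strip bridge words -/

/-- The `n`-step vertex-function bridges of span `L` from height `y` to height `y'` staying at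
heights in `[0, W)` inject (by `wordOf`, left inverse `traj_wordOf`) into the self-avoiding bridge
words of length `n` and span `L` fitting from `y`. [cite: MadrasSlade1993, §1.1] -/
theorem card_stripBridges_filter_le (n W : ℕ) (L y y' : ℤ) :
    ((Zd.bridges 2 n).filter (fun ω => ω n 0 = L ∧ y + ω n 1 = y' ∧
        ∀ i ≤ n, 0 ≤ y + ω i 1 ∧ y + ω i 1 < W)).card ≤
      ((sawWords n).filter (fun w => IsBridgeW w ∧ xEnd w = L ∧
        ∀ i ≤ w.length, 0 ≤ y + traj w i 1 ∧ y + traj w i 1 < W)).card := by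
  refine Finset.card_le_card_of_injOn (fun ω => wordOf n ω) (fun ω hω => ?_) ?_
  · rw [Finset.mem_coe, Finset.mem_filter, Zd.mem_bridges] at hω
    obtain ⟨⟨hω, hb⟩, hL, -, hfit⟩ := hω
    have hsaw : IsSAW (wordOf n ω) := by
      rw [isSAW_iff_injOn, traj_wordOf hω, length_wordOf]
      exact (Zd.mem_saws.1 hω).2.2.2
    rw [Finset.mem_coe, Finset.mem_filter, mem_sawWords]
    refine ⟨⟨length_wordOf n ω, hsaw⟩, ?_, ?_, fun i hi => ?_⟩
    · show Zd.IsBridge (wordOf n ω).length (traj (wordOf n ω))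
      rw [length_wordOf, traj_wordOf hω]
      exact hb
    · show traj (wordOf n ω) (wordOf n ω).length 0 = L
      rw [length_wordOf, traj_wordOf hω]
      exact hL
    · rw [length_wordOf] at hi
      rw [traj_wordOf hω]
      exact hfit i hi
  · intro ω hω ω' hω' h
    rw [Finset.mem_coe, Finset.mem_filter, Zd.mem_bridges] at hω hω'
    have h' : wordOf n ω = wordOf n ω' := h
    calc ω = traj (wordOf n ω) := (traj_wordOf hω.1.1).symm
      _ = traj (wordOf n ω') := by rw [h']
      _ = ω' := traj_wordOf hω'.1.1

/-- **Transfer to words.** The critical mass (partial sum over `n ≤ N`) of the vertex-function strip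
bridges of span `L` from height `y` to height `y'` is at most the critical mass of the strip bridge
words of length `≤ N` and span `L` fitting from `y` (constant inner sums,
`card_stripBridges_filter_le`, disjoint lengths). [cite: MadrasSlade1993, §1.1] -/
theorem stripBridgeMass_le_wordMass (W N : ℕ) (L y y' : ℤ) :
    ∑ n ∈ Finset.range (N + 1),
        ∑ _ω ∈ (Zd.bridges 2 n).filter (fun ω =>
            ω n 0 = L ∧ y + ω n 1 = y' ∧ ∀ i ≤ n, 0 ≤ y + ω i 1 ∧ y + ω i 1 < W),
          criticalFugacity ^ n ≤
      ∑ w ∈ ((Finset.range (N + 1)).biUnion sawWords).filter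
          (fun w => IsBridgeW w ∧ xEnd w = L ∧
            ∀ i ≤ w.length, 0 ≤ y + traj w i 1 ∧ y + traj w i 1 < W),
        criticalFugacity ^ w.length := by
  have hxc : 0 ≤ criticalFugacity := StripMass.criticalFugacity_pos.le
  -- per length `n`: both inner sums are constant sums, compare the cardinalities
  have hstep : ∀ n : ℕ,
      ∑ _ω ∈ (Zd.bridges 2 n).filter (fun ω =>
          ω n 0 = L ∧ y + ω n 1 = y' ∧ ∀ i ≤ n, 0 ≤ y + ω i 1 ∧ y + ω i 1 < W),
        criticalFugacity ^ n ≤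
      ∑ w ∈ (sawWords n).filter (fun w => IsBridgeW w ∧ xEnd w = L ∧
          ∀ i ≤ w.length, 0 ≤ y + traj w i 1 ∧ y + traj w i 1 < W),
        criticalFugacity ^ w.length := by
    intro n
    rw [Finset.sum_const, nsmul_eq_mul]
    refine le_trans (mul_le_mul_of_nonneg_right
      (Nat.cast_le.2 (card_stripBridges_filter_le n W L y y')) (pow_nonneg hxc _)) ?_
    rw [← nsmul_eq_mul, ← Finset.sum_const]
    exact Finset.sum_le_sum fun w hw => by rw [(mem_sawWords.1 (Finset.mem_filter.1 hw).1).1]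
  -- the sets of words of different lengths are disjoint
  have hdisj : Set.PairwiseDisjoint (↑(Finset.range (N + 1)) : Set ℕ)
      (fun n => (sawWords n).filter (fun w => IsBridgeW w ∧ xEnd w = L ∧
        ∀ i ≤ w.length, 0 ≤ y + traj w i 1 ∧ y + traj w i 1 < W)) := by
    intro m _ n _ hmn
    rw [Function.onFun, Finset.disjoint_left]
    intro w hwm hwn
    exact hmn ((mem_sawWords.1 (Finset.mem_filter.1 hwm).1).1.symm.trans
      (mem_sawWords.1 (Finset.mem_filter.1 hwn).1).1)
  refine (Finset.sum_le_sum fun n _ => hstep n).trans ?_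
  rw [Finset.filter_biUnion, Finset.sum_biUnion hdisj]

/-- For `u > 0`, `q = e^{-u}` and `B = (u + 1)/u` satisfy `1 + q B ≤ B`, i.e. `(u + 1) e^{-u} ≤ 1`.
[folklore] -/
theorem one_add_mul_le {u : ℝ} (hu : 0 < u) :
    1 + Real.exp (-u) * ((u + 1) / u) ≤ (u + 1) / u := by
  have key : Real.exp (-u) * (u + 1) ≤ 1 :=
    calc Real.exp (-u) * (u + 1) ≤ Real.exp (-u) * Real.exp u :=
          mul_le_mul_of_nonneg_left (Real.add_one_le_exp u) (Real.exp_pos _).le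
      _ = 1 := by rw [← Real.exp_add, neg_add_cancel, Real.exp_zero]
  rw [le_div_iff₀ hu, add_mul, one_mul, mul_assoc, div_mul_cancel₀ _ hu.ne']
  linarith

end StripRenewal

/-- **S2 — STRIP RENEWAL** (stub `stub_stripDecay_of_tiltedKraft` of line `kesten-defect-renewal`
for crux `ShellCrossingBound`, item stmt-CriticalPhenomena-4728): the tilted Kraft inequality for
the irreducible bridges confined to the width-`W` strip (stub S1, the hypothesis) implies that for
`c' = c/2 > 0` and `A = 2/c + 1`, for all `W ≥ 1`, heights `0 ≤ y, y' < W`, spans `L ≥ 1` and all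
`N`, the critical mass `Σ_{n ≤ N} Σ_ω x_c^n` of the vertex-function strip bridges of span `L` from
height `y` to height `y'` is `≤ A · W · e^{-c' L / W}`. Madras–Slade §4.2 renewal inside the strip
at the plane's `x_c`: row sums `≤ e^{-u}` at tilt `u = c/(2W)` (`rowBound_of_tiltedKraft`),
Neumann bound `(u+1)/u` (`stripWordMass_le`), span restriction, transfer words ↔ vertex
functions; Kesten's identity is not used. [cite: MadrasSlade1993, §4.2, eq. (4.2.2)–(4.2.12)] -/
theorem stub_stripDecay_of_tiltedKraft :
    (∃ c : ℝ, 0 < c ∧ ∀ W : ℕ, 1 ≤ W → ∀ y : ℤ, 0 ≤ y → y < W →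
      ∀ s : Finset {w : List SAW.Step // SAW.IsIrrBridge w},
        (∑ w ∈ s with (∀ i ≤ w.1.length, 0 ≤ y + SAW.traj w.1 i 1 ∧ y + SAW.traj w.1 i 1 < W),
          SAW.criticalFugacity ^ w.1.length * Real.exp (c * (SAW.xEnd w.1 : ℝ) / W)) ≤ 1) →
    ∃ c : ℝ, 0 < c ∧ ∃ A : ℝ, ∀ W : ℕ, 1 ≤ W → ∀ y y' : ℤ, 0 ≤ y → y < W → 0 ≤ y' → y' < W →
      ∀ L : ℕ, 1 ≤ L → ∀ N : ℕ,
        (∑ n ∈ Finset.range (N + 1),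
          ∑ _ω ∈ (SAW.Zd.bridges 2 n).filter (fun ω =>
              ω n 0 = (L : ℤ) ∧ y + ω n 1 = y' ∧ ∀ i ≤ n, 0 ≤ y + ω i 1 ∧ y + ω i 1 < W),
            SAW.criticalFugacity ^ n) ≤ A * W * Real.exp (-(c * L / W)) := by
  rintro ⟨c, hc, hS1⟩
  refine ⟨c / 2, by positivity, 2 / c + 1, ?_⟩
  intro W hW y y' hy0 hyW _hy0' _hyW' L _hL N
  have hW1 : (1 : ℝ) ≤ W := Nat.one_le_cast.2 hW
  -- the tilt `u = c/(2W)`; row sums `≤ e^{-u}`; Neumann bound `B = (u+1)/u`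
  have hu : 0 < c / 2 / W := by positivity
  have hrow : ∀ y'' : ℤ, 0 ≤ y'' → y'' < W → ∀ S : Finset (List SAW.Step),
      (∀ s ∈ S, SAW.IsIrrBridge s) →
      ∑ s ∈ S with (∀ i ≤ s.length, 0 ≤ y'' + SAW.traj s i 1 ∧ y'' + SAW.traj s i 1 < W),
        SAW.criticalFugacity ^ s.length * Real.exp (c / 2 / W * (SAW.xEnd s : ℝ)) ≤
        Real.exp (-(c / 2 / W)) :=
    fun y'' h0 hW' S hS => StripRenewal.rowBound_of_tiltedKraft hc.le (hS1 W hW y'' h0 hW') S hS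
  have hmass := StripRenewal.stripWordMass_le (StripRenewal.one_add_mul_le hu)
    (by rw [le_div_iff₀ hu]; linarith) hrow N y hy0 hyW
  refine ((StripRenewal.stripBridgeMass_le_wordMass W N (L : ℤ) y y').trans
    (StripRenewal.stripWordMass_span_le hmass (L : ℤ))).trans ?_
  -- constants: `e^{-uL} (u+1)/u ≤ (2/c + 1) W e^{-(c/2) L / W}`
  have hexp : Real.exp (-(c / 2 / W * ((L : ℤ) : ℝ))) = Real.exp (-(c / 2 * L / W)) := by
    congr 1
    push_cast
    ring
  rw [hexp, mul_comm]
  refine mul_le_mul_of_nonneg_right ?_ (Real.exp_pos _).le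
  rw [div_le_iff₀ hu]
  have h1 : (2 / c + 1) * W * (c / 2 / W) = 1 + c / 2 := by
    field_simp
  have h2 : c / 2 / W ≤ c / 2 := div_le_self (by positivity) hW1
  rw [h1]
  linarith

end Summit.CriticalPhenomena.SAWScalingLimit.Theorems
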